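import Summits.BirchSwinnertonDyer.Rank1Residual.X4.OldPairOfIharaSurj
import Summits.BirchSwinnertonDyer.Rank1Residual.X4.LevelLoweringOfOldOnCycles
import Summits.BirchSwinnertonDyer.Rank1Residual.X4.OldShapeOfIhara
import HarnessLib

/-!
# The `ℓ`-old shape at an ADDITIVE defect prime (`ℓ ∣ M`, `a_ℓ(f) = 0`) and the level-lowering certificate on paths from two-copy Ihara surjectivity at one ideal (cell `b2b-bsdres`, seat additive-p4, line V48)

HONEST FRAMING (verbatim, cell `b2b-bsdres`): the goal of the cell is to DELETE the COMBINATION-SHAPED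
residual classes for ALL analytic-rank `≤ 1` curves over `ℚ` — "full BSD formula for every rank `≤ 1`
curve in class `C`" assembled STRICTLY from published theorems — so that the rank-`≤ 1` remainder
becomes exactly the CONSTRUCTION-SHAPED classes, which are TYPED (missing-input Props), NOT attempted;
this is not "finishing BSD". This file: TOOL theorems (modular symbols / period homology), 0 defs,
0 facts, nothing booked; X4 CONSTRUCTION-SHAPED. It is the `ℓ ∣ M` twin of
`X4/OldShapeOfIhara` + `X4/LevelLoweringOfOldOnCycles` (line V45), for the NL residue of
TAM-DEFECT₂ (ADDITIVE defect primes: `ℓ² ∥ N`, `p = 3`, Kodaira IV/IV*, `c_ℓ = 3`).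

## What is proved

* `heckeT_degeneracyMap0_one_of_dvd`: for `ℓ ∣ M`, `U_ℓ^{(Mℓ)} [α₁] g = [α₁] U_ℓ^{(M)} g`
  (`q`-expansions: both are `∑ a_{ℓn}(g) qⁿ`); with the tree's `heckeT_degeneracyMap0_self`
  (`U_ℓ [α_ℓ] g = ℓ [α₁] g`, any `ℓ`) these are the two `U_ℓ`/degeneracy relations at an additive
  prime. Dual forms on `S₂^∨`.
* `additiveOldShape_of_eigenPair_of_surj`: if `Φ = Λ₁∘α_* + Λ₂∘β_*` on `H₁(X₀(Mℓ), ℤ)` with `Λ₁, Λ₂`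
  `χ`-eigen, `Φ ∘ U_ℓ^∨ = 0` there (`a_ℓ(f) = 0`: ADDITIVE reduction), `ℓ` invertible in `k`, and some
  `s ∉ ker χ` multiplies `H₁(X₀(M), ℤ)²` into `im(α_*, β_*)`, then `Λ₂ = −ℓ⁻¹ Λ₁ ∘ U_ℓ^{(M)∨}` on
  `H₁(X₀(M), ℤ)` (evaluate `Φ(U_ℓ^∨ z) = 0` at a cycle `z` over `(s x, 0)`).
* `exists_sub_mul_of_oldOnCycles_additive_of_surjAt` — THE ASSEMBLY for `ℓ ∣ M`: data as in
  `exists_sub_mul_of_oldOnCycles_of_ribet1984_iharaLemma` (a `θ̄`-eigen additive `Ψ` on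
  `P ⊇ H₁(X₀(Mℓ), ℤ) ∪ {σ r}` carrying `φ` on paths, an `ℓ`-old decomposition (★★) with additive
  components, the numeral `q₀`) but with `θ(ℓ) ≡ 0`, `ℓ ≢ 0 (mod p)`, the two-copy surjectivity
  `hS` at every maximal `𝔫 ∋ p, T_r − θ(r)` (not Eisenstein) INSTEAD of Ihara's lemma, and the
  `U_ℓ`-SIGN input `hU` (some `s₂ ∉ 𝔫` with `s₂(U_ℓ − w) = 0` on `H₁(X₀(M), ℤ)`: `U_ℓ ≡ w` on the
  `𝔫`-part) ⟹ a `1`-periodic `μ : ℚ → 𝔽_p`, `T_q`-eigen (`q ∤ Mℓ`) with eigenvalue `θ(q)`, and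
  `φ(r) = μ(r) − (ℓ⁻¹ w) μ(ℓ r)` for ALL `r`. For `w ≡ ℓ` this is EXACTLY gen 20's certificate shape
  `φ = μ − μ∘[ℓ]` (`PlusSymbolLevelLowersAt`), which kills every mod-`p` Kurihara number.

WHY `w ≡ ℓ` is the right input (theory, not asserted): on a TAM-DEFECT row the level-lowered newform
`g` of level `M = N/ℓ` is `ℓ`-new with `U_ℓ g = w g`, `w = a_ℓ(g) = η(Frob_ℓ)` for the unramified
character `η` of `ρ̄|_{D_ℓ} ≃ (ηχ̄, *; 0, η)` (Carayol); `p ∣ c_ℓ` means `W(ℚ_ℓ)[p] ≠ 0`, i.e. the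
stable line `ηχ̄` is trivial on `D_ℓ`: `wℓ ≡ 1`, `w ≡ ℓ⁻¹ ≡ ℓ (mod 3)`. Conversely the Kurihara sum of
`μ − (w/ℓ)μ∘[ℓ]` is `(1 − w/ℓ)·δ̃_n(μ)` (re-indexing `a ↦ ℓ⁻¹a` in `X4/KuriharaLevelLowering`), so the
killing needs `w ≡ ℓ` exactly.

## References

* F. Diamond, J. Shurman, *A First Course in Modular Forms* (2005), Prop. 5.6.2, §5.7. [cite: DiamondShurman2005, Prop. 5.6.2]
* K. A. Ribet, Proc. ICM 1983 (1984), Thm. 4.1. [cite: Ribet1984ICM, Thm. 4.1]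
* F. Diamond, K. Ribet, in Cornell–Silverman–Stevens (1997), §4.4 Lemma 4.6. [cite: DiamondRibet1997, §4.4 Lemma 4.6]
* Ju. I. Manin, Izv. Akad. Nauk SSSR 36 (1972), Thm. 3.3 (20), Thm. 3.5 (22). [cite: Manin1972, Thm. 3.3 (20) and Thm. 3.5 (22)]
* B. Mazur, J. Tate, J. Teitelbaum, Invent. Math. 84 (1986), §I.4 (4.2). [cite: MazurTateTeitelbaum1986Invent, §I.4 (4.2)]
* H. Carayol, Ann. Sci. ÉNS 19 (1986), Thm. (A) (local-global compatibility at `ℓ ∥ N`). [cite: Carayol1986, Thm. (A)]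
-/

noncomputable section

open scoped MatrixGroups ModularForm

open CongruenceSubgroup Finset Matrix

open Literature.NumberTheory.EllipticCurves Literature.NumberTheory.EllipticCurves.ModularForms
  Literature.NumberTheory.EllipticCurves.ModularForms.HidaCohomology

namespace Summit.BirchSwinnertonDyer.Rank1Residual.LevelLowering

/-! ### §1 `U_ℓ` and the degeneracy maps when `ℓ ∣ M` -/

section Intertwining

variable {M : ℕ} [NeZero M] {ℓ : ℕ} [Fact ℓ.Prime]

/-- **`U_ℓ^{(Mℓ)} [α₁] g = [α₁] U_ℓ^{(M)} g`** for `g ∈ S₂(Γ₀(M))` and a prime `ℓ ∣ M` (both sides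
have `q`-expansion `∑ a_{ℓn}(g) qⁿ`: at a prime dividing the level `T_ℓ` is `U_ℓ`; Diamond–Shurman
Prop. 5.2.2 (a), §5.7). [cite: DiamondShurman2005, Prop. 5.6.2] -/
theorem heckeT_degeneracyMap0_one_of_dvd (hℓM : ℓ ∣ M) (g : CuspForm (Gamma0 M) 2) :
    heckeT (Gamma0 (M * ℓ)) 2 ℓ (degeneracyMap0 M (M * ℓ) 1 2 g) =
      degeneracyMap0 M (M * ℓ) 1 2 (heckeT (Gamma0 M) 2 ℓ g) := by
  have hℓ : ℓ.Prime := Fact.out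
  haveI : NeZero ℓ := ⟨hℓ.ne_zero⟩
  have h1 : M * 1 ∣ M * ℓ := by rw [mul_one]; exact dvd_mul_right M ℓ
  have hz1 : ((1 : ℕ) : ℂ) ^ ((2 : ℤ) - 1) = 1 := by norm_num
  refine eq_of_forall_cuspCoeff_eq (one_mem_strictPeriods_gamma0 (M * ℓ)) fun n ↦ ?_
  simp only [cuspCoeff]
  rw [qExpansion_coeff_heckeT_holds (M * ℓ) 2 _ ℓ hℓ n, if_pos (dvd_mul_left ℓ M), add_zero,
    degeneracyMap0_eq_smul_iota M (M * ℓ) 1 2 h1, degeneracyMap0_eq_smul_iota M (M * ℓ) 1 2 h1,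
    qExpansion_coeff_smul, qExpansion_coeff_smul, qExpansion_coeff_iota, qExpansion_coeff_iota,
    hz1, one_mul, one_mul, if_pos (one_dvd _), if_pos (one_dvd _), Nat.div_one, Nat.div_one,
    qExpansion_coeff_heckeT_holds M 2 g ℓ hℓ n, if_pos hℓM, add_zero]

/-- **`α_* ∘ U_ℓ^{(Mℓ)∨} = U_ℓ^{(M)∨} ∘ α_*`** on `S₂(Γ₀(Mℓ))^∨` for `ℓ ∣ M` (transpose of
`heckeT_degeneracyMap0_one_of_dvd`). [cite: DiamondShurman2005, Prop. 5.6.2] -/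
theorem dualMap_degeneracyMap0_one_dualMap_heckeT_of_dvd (hℓM : ℓ ∣ M)
    (z : Module.Dual ℂ (CuspForm (Gamma0 (M * ℓ)) 2)) :
    (degeneracyMap0 M (M * ℓ) 1 2).dualMap ((heckeT (Gamma0 (M * ℓ)) 2 ℓ).dualMap z) =
      (heckeT (Gamma0 M) 2 ℓ).dualMap ((degeneracyMap0 M (M * ℓ) 1 2).dualMap z) := by
  ext g
  simp only [LinearMap.dualMap_apply, heckeT_degeneracyMap0_one_of_dvd hℓM]

end Intertwining

/-! ### §2 The additive old shape: `Λ₂ = −ℓ⁻¹ Λ₁ ∘ U_ℓ^∨` -/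

section AdditiveShape

variable {k : Type*} [Field k] {M : ℕ} [NeZero M] {ℓ : ℕ} [Fact ℓ.Prime]

/-- **THE `ℓ`-OLD SHAPE AT AN ADDITIVE PRIME.** `ℓ ∣ M` prime, `Φ` on `S₂(Γ₀(Mℓ))^∨`, `Λ₁, Λ₂` on
`S₂(Γ₀(M))^∨` additive and `χ`-eigen on `H₁(X₀(M), ℤ)`, `Φ = Λ₁∘α_* + Λ₂∘β_*` on
`H₁(X₀(Mℓ), ℤ)`, `Φ ∘ U_ℓ^∨ = 0` there (`a_ℓ = 0`), `ℓ ≠ 0` in `k`, and `s ∉ ker χ` multiplying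
`H₁(X₀(M), ℤ)²` into `im(α_*, β_*)`. Then `Λ₂(x) = −ℓ⁻¹ Λ₁(U_ℓ^∨ x)` for every cycle `x`: at a cycle
`z` over `(s x, 0)`, `0 = Φ(U_ℓ^∨ z) = Λ₁(U_ℓ^∨(s x)) + Λ₂(ℓ s x) = χ(s)(Λ₁(U_ℓ^∨ x) + ℓ Λ₂(x))`.
[cite: DiamondShurman2005, Prop. 5.6.2] [cite: DiamondRibet1997, §4.4 Lemma 4.6] -/
theorem additiveOldShape_of_eigenPair_of_surj (hℓM : ℓ ∣ M)
    (Φ : Module.Dual ℂ (CuspForm (Gamma0 (M * ℓ)) 2) → k)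
    (Λ₁ Λ₂ : Module.Dual ℂ (CuspForm (Gamma0 M) 2) → k) (χ : HeckeRing0.primeTo M 2 (M * ℓ) →+* k)
    (hΛ₁ : ∀ (s : HeckeRing0.primeTo M 2 (M * ℓ)), ∀ x ∈ periodHomology M,
      Λ₁ ((s : HeckeRing0 M 2) • x) = χ s * Λ₁ x)
    (hΛ₂ : ∀ (s : HeckeRing0.primeTo M 2 (M * ℓ)), ∀ x ∈ periodHomology M,
      Λ₂ ((s : HeckeRing0 M 2) • x) = χ s * Λ₂ x)
    (hadd₂ : ∀ x ∈ periodHomology M, ∀ y ∈ periodHomology M, Λ₂ (x + y) = Λ₂ x + Λ₂ y)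
    {s : HeckeRing0.primeTo M 2 (M * ℓ)} (hs : s ∉ RingHom.ker χ)
    (hsur : ∀ x ∈ periodHomology M, ∀ y ∈ periodHomology M, ∃ z ∈ periodHomology (M * ℓ),
      (degeneracyMap0 M (M * ℓ) 1 2).dualMap z = (s : HeckeRing0 M 2) • x ∧
      (degeneracyMap0 M (M * ℓ) ℓ 2).dualMap z = (s : HeckeRing0 M 2) • y)
    (hΦ : ∀ z ∈ periodHomology (M * ℓ),
      Φ z = Λ₁ ((degeneracyMap0 M (M * ℓ) 1 2).dualMap z) +
        Λ₂ ((degeneracyMap0 M (M * ℓ) ℓ 2).dualMap z))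
    (hU0 : ∀ z ∈ periodHomology (M * ℓ), Φ ((heckeT (Gamma0 (M * ℓ)) 2 ℓ).dualMap z) = 0)
    (hℓk : (ℓ : k) ≠ 0) :
    ∀ x ∈ periodHomology M, Λ₂ x = -((ℓ : k)⁻¹ * Λ₁ ((heckeT (Gamma0 M) 2 ℓ).dualMap x)) := by
  have hℓ : ℓ.Prime := Fact.out
  haveI : NeZero ℓ := ⟨hℓ.ne_zero⟩
  have h0₂ : Λ₂ 0 = 0 := apply_zero_eq_zero_of_eigen Λ₂ χ hΛ₂
  have hcs : χ s ≠ 0 := fun h ↦ hs (by rwa [RingHom.mem_ker])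
  -- `U_ℓ^∨` commutes with `𝕋̃` on the dual space
  have hcomm : ∀ (s : HeckeRing0.primeTo M 2 (M * ℓ)) (x : Module.Dual ℂ (CuspForm (Gamma0 M) 2)),
      (heckeT (Gamma0 M) 2 ℓ).dualMap ((s : HeckeRing0 M 2) • x) =
        (s : HeckeRing0 M 2) • (heckeT (Gamma0 M) 2 ℓ).dualMap x := by
    intro s x
    rw [dualMap_heckeT_eq_T_smul hℓ, dualMap_heckeT_eq_T_smul hℓ, smul_smul, smul_smul, mul_comm]
  intro x hx
  have hTx : (heckeT (Gamma0 M) 2 ℓ).dualMap x ∈ periodHomology M :=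
    dualMap_heckeT_mem_periodHomology M hℓ hx
  obtain ⟨z, hz, hα, -⟩ := hsur x hx 0 (zero_mem _)
  have hUz : (heckeT (Gamma0 (M * ℓ)) 2 ℓ).dualMap z ∈ periodHomology (M * ℓ) :=
    dualMap_heckeT_mem_periodHomology (M * ℓ) hℓ hz
  have h := hU0 z hz
  rw [hΦ _ hUz, dualMap_degeneracyMap0_one_dualMap_heckeT_of_dvd hℓM,
    dualMap_degeneracyMap0_self_dualMap_heckeT, hα, hcomm s x, hΛ₁ s _ hTx,
    apply_natCast_smul_of_additive Λ₂ h0₂ hadd₂ (HeckeRing0.smul_mem_periodHomology M _ hx) ℓ,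
    hΛ₂ s x hx] at h
  -- `h : χ s * Λ₁ (U x) + ℓ * (χ s * Λ₂ x) = 0`
  have h' : Λ₁ ((heckeT (Gamma0 M) 2 ℓ).dualMap x) + (ℓ : k) * Λ₂ x = 0 := by
    have e : χ s * (Λ₁ ((heckeT (Gamma0 M) 2 ℓ).dualMap x) + (ℓ : k) * Λ₂ x) = 0 := by
      linear_combination h
    exact (mul_eq_zero.mp e).resolve_left hcs
  have e2 : (ℓ : k) * Λ₂ x = -Λ₁ ((heckeT (Gamma0 M) 2 ℓ).dualMap x) := by linear_combination h'
  calc Λ₂ x = (ℓ : k)⁻¹ * ((ℓ : k) * Λ₂ x) := by rw [← mul_assoc, inv_mul_cancel₀ hℓk, one_mul]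
    _ = -((ℓ : k)⁻¹ * Λ₁ ((heckeT (Gamma0 M) 2 ℓ).dualMap x)) := by rw [e2]; ring

end AdditiveShape

/-! ### §3 The assembly for `ℓ ∣ M`: (★★) on cycles ⟹ the certificate on paths -/

section Assembly

variable {M : ℕ} [NeZero M] {ℓ : ℕ} [Fact ℓ.Prime] {p : ℕ} [hp : Fact p.Prime]

/-- **(★★) ON CYCLES ⟹ THE LEVEL-LOWERING CERTIFICATE ON PATHS AT AN ADDITIVE PRIME** (`ℓ ∣ M`,
`θ(ℓ) ≡ 0`, `p ∤ ℓ`). Data as in `exists_sub_mul_of_oldOnCycles_of_ribet1984_iharaLemma` (V45),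
with Ihara's lemma replaced by the two-copy surjectivity `hS` at every maximal `𝔫 ∋ p, T_r − θ(r)`
(not Eisenstein), and the `U_ℓ`-SIGN input `hU` (`s₂(U_ℓ − w) = 0` on `H₁(X₀(M), ℤ)` for some
`s₂ ∉ 𝔫`). Conclusion: a `1`-periodic `μ : ℚ → 𝔽_p`, `T_q`-eigen with eigenvalue `θ(q)` at every
prime `q ∤ Mℓ`, with `φ(r) = μ(r) − (ℓ⁻¹ w) μ(ℓ r)` for ALL `r ∈ ℚ`. PROOF: dichotomy
(`X4/LevelLoweringCharacter`); in the character branch the Fitting projection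
(`exists_eigenPair_of_oldPair_of_surj`) makes the pair `χ`-eigen,
`additiveOldShape_of_eigenPair_of_surj` + `hU` force `Ψ = Λ₁∘α_* − (ℓ⁻¹w) Λ₁∘β_*` on cycles, and
CLOSING THE PATH at `q₀` (Manin) defines `μ(r) = (θ(q₀) − q₀ − 1)⁻¹ Λ₁((T_{q₀} − q₀ − 1){∞, r})`.
[cite: Manin1972, Thm. 3.3 (20) and Thm. 3.5 (22)] [cite: MazurTateTeitelbaum1986Invent, §I.4 (4.2)]
[cite: DiamondRibet1997, §4.4 Lemma 4.6] -/
theorem exists_sub_mul_of_oldOnCycles_additive_of_surjAt (hℓM : ℓ ∣ M) (θ : ℕ → ℤ)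
    (hθℓ : ((θ ℓ : ℤ) : ZMod p) = 0) (hℓp : (ℓ : ZMod p) ≠ 0)
    -- symbol functionals at the two levels
    (σ : ℚ → Module.Dual ℂ (CuspForm (Gamma0 (M * ℓ)) 2))
    (hσ : ∀ (r : ℚ) (f : CuspForm (Gamma0 (M * ℓ)) 2), σ r f = modularSymbol f r)
    (σ' : ℚ → Module.Dual ℂ (CuspForm (Gamma0 M) 2))
    (hσ' : ∀ (r : ℚ) (f : CuspForm (Gamma0 M) 2), σ' r f = modularSymbol f r)
    -- the functional `Ψ` on `P ⊇ H₁(X₀(Mℓ), ℤ) ∪ {σ r}` carrying `φ`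
    (P : AddSubgroup (Module.Dual ℂ (CuspForm (Gamma0 (M * ℓ)) 2)))
    (Ψ : Module.Dual ℂ (CuspForm (Gamma0 (M * ℓ)) 2) → ZMod p) (φ : ℚ → ZMod p)
    (hσP : ∀ r : ℚ, σ r ∈ P) (hHP : periodHomology (M * ℓ) ≤ P)
    (hTP : ∀ (q : ℕ) (hq : q.Prime), ∀ z ∈ P, HeckeRing0.T (M * ℓ) 2 q hq • z ∈ P)
    (hΨadd : ∀ x ∈ P, ∀ y ∈ P, Ψ (x + y) = Ψ x + Ψ y) (hΨσ : ∀ r : ℚ, Ψ (σ r) = φ r)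
    (hΨT : ∀ (q : ℕ) (hq : q.Prime), ∀ z ∈ P,
      Ψ (HeckeRing0.T (M * ℓ) 2 q hq • z) = ((θ q : ℤ) : ZMod p) * Ψ z)
    -- (★★) `Ψ` is `ℓ`-old on cycles
    (Λ₁ Λ₂ : Module.Dual ℂ (CuspForm (Gamma0 M) 2) → ZMod p)
    (hadd₁ : ∀ x ∈ periodHomology M, ∀ y ∈ periodHomology M, Λ₁ (x + y) = Λ₁ x + Λ₁ y)
    (hadd₂ : ∀ x ∈ periodHomology M, ∀ y ∈ periodHomology M, Λ₂ (x + y) = Λ₂ x + Λ₂ y)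
    (hold : ∀ z ∈ periodHomology (M * ℓ),
      Ψ z = Λ₁ ((degeneracyMap0 M (M * ℓ) 1 2).dualMap z) +
        Λ₂ ((degeneracyMap0 M (M * ℓ) ℓ 2).dualMap z))
    -- the non-Eisenstein numeral
    {q₀ : ℕ} (hq₀ : q₀.Prime) (hq₀1 : q₀ ≡ 1 [MOD M * ℓ])
    (hθq₀ : ((θ q₀ : ℤ) : ZMod p) ≠ q₀ + 1)
    -- two-copy Ihara surjectivity at the maximal ideals of `θ̄`
    (hS : ∀ 𝔫 : Ideal (HeckeRing0.primeTo M 2 (M * ℓ)), 𝔫.IsMaximal →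
      (p : HeckeRing0.primeTo M 2 (M * ℓ)) ∈ 𝔫 →
      (∀ (r : ℕ) (hr : r.Prime) (hrS : ¬ r ∣ M * ℓ),
        HeckeRing0.primeTo.T M 2 (M * ℓ) hr hrS - (θ r : HeckeRing0.primeTo M 2 (M * ℓ)) ∈ 𝔫) →
      ¬ HeckeRing0.primeTo.IsEisenstein 𝔫 →
      ∃ s : HeckeRing0.primeTo M 2 (M * ℓ), s ∉ 𝔫 ∧
        ∀ x ∈ periodHomology M, ∀ y ∈ periodHomology M, ∃ z ∈ periodHomology (M * ℓ),
          (degeneracyMap0 M (M * ℓ) 1 2).dualMap z = (s : HeckeRing0 M 2) • x ∧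
          (degeneracyMap0 M (M * ℓ) ℓ 2).dualMap z = (s : HeckeRing0 M 2) • y)
    -- the `U_ℓ`-sign input: `U_ℓ ≡ w` on the `𝔫`-part of `H₁(X₀(M), ℤ)`
    (w : ℤ)
    (hU : ∀ 𝔫 : Ideal (HeckeRing0.primeTo M 2 (M * ℓ)), 𝔫.IsMaximal →
      (p : HeckeRing0.primeTo M 2 (M * ℓ)) ∈ 𝔫 →
      (∀ (r : ℕ) (hr : r.Prime) (hrS : ¬ r ∣ M * ℓ),
        HeckeRing0.primeTo.T M 2 (M * ℓ) hr hrS - (θ r : HeckeRing0.primeTo M 2 (M * ℓ)) ∈ 𝔫) →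
      ¬ HeckeRing0.primeTo.IsEisenstein 𝔫 →
      ∃ s₂ : HeckeRing0.primeTo M 2 (M * ℓ), s₂ ∉ 𝔫 ∧
        ∀ x ∈ periodHomology M,
          (s₂ : HeckeRing0 M 2) • (HeckeRing0.T M 2 ℓ (Fact.out : ℓ.Prime) • x) =
            (s₂ : HeckeRing0 M 2) • ((w : HeckeRing0 M 2) • x)) :
    ∃ μ : ℚ → ZMod p, IsPeriodic μ ∧
      (∀ q : ℕ, q.Prime → ¬ q ∣ M * ℓ → HeckeRel μ q ((θ q : ℤ) : ZMod p)) ∧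
      ∀ r : ℚ, φ r = μ r - ((ℓ : ZMod p)⁻¹ * (w : ZMod p)) * μ (ℓ * r) := by
  classical
  have hℓ : ℓ.Prime := Fact.out
  haveI : NeZero ℓ := ⟨hℓ.ne_zero⟩
  haveI : NeZero q₀ := ⟨hq₀.ne_zero⟩
  have h1d : M * 1 ∣ M * ℓ := by rw [mul_one]; exact dvd_mul_right M ℓ
  have hℓd : M * ℓ ∣ M * ℓ := dvd_rfl
  have hq₀1M : q₀ ≡ 1 [MOD M] := hq₀1.of_mul_right ℓ
  have hq₀N : ¬ q₀ ∣ M * ℓ := by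
    intro hd
    have h01 : 1 ≡ 0 [MOD q₀] :=
      ((hq₀1.of_dvd hd).symm.trans (Nat.modEq_zero_iff_dvd.mpr (dvd_refl q₀)))
    exact hq₀.one_lt.ne' (Nat.dvd_one.mp (Nat.modEq_zero_iff_dvd.mp h01))
  -- the cycle defect `Y r = T_{q₀} • σ r − (q₀+1) • σ r ∈ H₁(X₀(Mℓ), ℤ)` and its value under `Ψ`
  have hY : ∀ r, HeckeRing0.T (M * ℓ) 2 q₀ hq₀ • σ r - ((q₀ + 1 : ℕ) : ℂ) • σ r ∈ periodHomology (M * ℓ) :=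
    T_smul_sub_smul_symbol_mem_periodHomology (M * ℓ) σ hσ hq₀ hq₀1
  have hΨY : ∀ r, Ψ (HeckeRing0.T (M * ℓ) 2 q₀ hq₀ • σ r - ((q₀ + 1 : ℕ) : ℂ) • σ r) =
      (((θ q₀ : ℤ) : ZMod p) - (q₀ + 1)) * φ r := by
    intro r
    rw [apply_sub_of_additiveOn Ψ hΨadd (hTP q₀ hq₀ _ (hσP r))
        (by rw [Nat.cast_smul_eq_nsmul]; exact P.nsmul_mem (hσP r) _),
      hΨT q₀ hq₀ _ (hσP r), apply_natCast_smul_of_additiveOn Ψ hΨadd (hσP r), hΨσ]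
    push_cast
    ring
  have hcne : (((θ q₀ : ℤ) : ZMod p) - (q₀ + 1)) ≠ 0 := sub_ne_zero.mpr hθq₀
  -- `α_*`, `β_*` of the cycle defect are the level-`M` cycle defects at `r` and `ℓ r`
  have hαY : ∀ r, (degeneracyMap0 M (M * ℓ) 1 2).dualMap
      (HeckeRing0.T (M * ℓ) 2 q₀ hq₀ • σ r - ((q₀ + 1 : ℕ) : ℂ) • σ r) =
      HeckeRing0.T M 2 q₀ hq₀ • σ' r - ((q₀ + 1 : ℕ) : ℂ) • σ' r := by
    intro r
    rw [map_sub, dualMap_degeneracyMap0_T_smul h1d hq₀ hq₀N, LinearMap.map_smul,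
      dualMap_degeneracyMap0_symbol h1d σ hσ σ' hσ' r, Nat.cast_one, one_mul]
  have hβY : ∀ r, (degeneracyMap0 M (M * ℓ) ℓ 2).dualMap
      (HeckeRing0.T (M * ℓ) 2 q₀ hq₀ • σ r - ((q₀ + 1 : ℕ) : ℂ) • σ r) =
      HeckeRing0.T M 2 q₀ hq₀ • σ' (ℓ * r) - ((q₀ + 1 : ℕ) : ℂ) • σ' (ℓ * r) := by
    intro r
    rw [map_sub, dualMap_degeneracyMap0_T_smul hℓd hq₀ hq₀N, LinearMap.map_smul,
      dualMap_degeneracyMap0_symbol hℓd σ hσ σ' hσ' r]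
  -- the dichotomy
  have hΨT' : ∀ (r : ℕ) (hr : r.Prime), ¬ r ∣ M * ℓ → ∀ z ∈ periodHomology (M * ℓ),
      Ψ (HeckeRing0.T (M * ℓ) 2 r hr • z) = ((θ r : ℤ) : ZMod p) * Ψ z :=
    fun r hr _ z hz ↦ hΨT r hr z (hHP hz)
  rcases apply_eq_zero_or_exists_ringHom_apply_T_eq (p := p) θ (ZMod.natCast_self p) Ψ Λ₁ Λ₂ hadd₁
      hadd₂ hΨT' hold with hzero | ⟨χ, hχ⟩
  · -- CASE 1: `Ψ = 0` on cycles ⟹ `φ = 0` on paths; `μ = 0`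
    refine ⟨fun _ ↦ 0, fun _ _ ↦ rfl, fun q _ _ r ↦ by simp, fun r ↦ ?_⟩
    have h := hΨY r
    rw [hzero _ (hY r)] at h
    have hφ : φ r = 0 := (mul_eq_zero.mp h.symm).resolve_left hcne
    rw [hφ, mul_zero, sub_zero]
  · -- CASE 2: `θ̄` is a character `χ` of the level-`M` Hecke ring
    have h𝔫 : (RingHom.ker χ).IsMaximal :=
      RingHom.ker_isMaximal_of_surjective χ (ZMod.ringHom_surjective χ)
    have hp𝔫 : (p : HeckeRing0.primeTo M 2 (M * ℓ)) ∈ RingHom.ker χ := by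
      rw [RingHom.mem_ker, map_natCast, ZMod.natCast_self]
    have hT𝔫 : ∀ (r : ℕ) (hr : r.Prime) (hrS : ¬ r ∣ M * ℓ),
        HeckeRing0.primeTo.T M 2 (M * ℓ) hr hrS - (θ r : HeckeRing0.primeTo M 2 (M * ℓ)) ∈
          RingHom.ker χ := fun r hr hrS ↦ by
      rw [RingHom.mem_ker, map_sub, hχ r hr hrS, map_intCast, sub_self]
    have hE : ¬ HeckeRing0.primeTo.IsEisenstein (RingHom.ker χ) := by
      intro hEis
      have h := hEis q₀ hq₀ hq₀N hq₀1
      rw [RingHom.mem_ker, map_sub, hχ q₀ hq₀ hq₀N, map_add, map_natCast, map_one, sub_eq_zero] at h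
      exact hθq₀ h
    have hΨTχ : ∀ (r : ℕ) (hr : r.Prime) (hrS : ¬ r ∣ M * ℓ), ∀ z ∈ periodHomology (M * ℓ),
        Ψ (HeckeRing0.T (M * ℓ) 2 r hr • z) = χ (HeckeRing0.primeTo.T M 2 (M * ℓ) hr hrS) * Ψ z :=
      fun r hr hrS z hz ↦ by rw [hχ r hr hrS]; exact hΨT r hr z (hHP hz)
    have hΨaddH : ∀ x ∈ periodHomology (M * ℓ), ∀ y ∈ periodHomology (M * ℓ), Ψ (x + y) = Ψ x + Ψ y :=
      fun x hx y hy ↦ hΨadd x (hHP hx) y (hHP hy)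
    -- the surjectivity element at `ker χ`, and the Fitting projection: eigen components
    obtain ⟨s, hs, hsur⟩ := hS (RingHom.ker χ) h𝔫 hp𝔫 hT𝔫 hE
    obtain ⟨Λ₁', Λ₂', hadd₁', hadd₂', hΛ₁', hΛ₂', hold'⟩ :=
      exists_eigenPair_of_oldPair_of_surj Ψ Λ₁ Λ₂ χ hadd₁ hadd₂ hΨaddH hΨTχ h𝔫 hs hsur hold
    -- `Ψ ∘ U_ℓ^∨ = 0` on cycles (`a_ℓ = 0`) ⟹ the additive old shape
    have hU0 : ∀ z ∈ periodHomology (M * ℓ), Ψ ((heckeT (Gamma0 (M * ℓ)) 2 ℓ).dualMap z) = 0 :=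
      fun z hz ↦ by rw [dualMap_heckeT_eq_T_smul hℓ, hΨT ℓ hℓ z (hHP hz), hθℓ, zero_mul]
    have hΛ₂'U := additiveOldShape_of_eigenPair_of_surj hℓM Ψ Λ₁' Λ₂' χ hΛ₁' hΛ₂' hadd₂' hs
      hsur hold' hU0 hℓp
    -- the `U_ℓ`-sign: `Λ₁'(U_ℓ^∨ x) = w Λ₁'(x)` on cycles
    obtain ⟨s₂, hs₂, hUw⟩ := hU (RingHom.ker χ) h𝔫 hp𝔫 hT𝔫 hE
    have hcs₂ : χ s₂ ≠ 0 := fun h ↦ hs₂ (by rwa [RingHom.mem_ker])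
    have hΛ₁'U : ∀ x ∈ periodHomology M,
        Λ₁' ((heckeT (Gamma0 M) 2 ℓ).dualMap x) = (w : ZMod p) * Λ₁' x := by
      intro x hx
      have hTx : HeckeRing0.T M 2 ℓ hℓ • x ∈ periodHomology M :=
        HeckeRing0.smul_mem_periodHomology M _ hx
      have hwx : (w : HeckeRing0 M 2) • x ∈ periodHomology M :=
        HeckeRing0.smul_mem_periodHomology M _ hx
      have e1 : Λ₁' ((s₂ : HeckeRing0 M 2) • (HeckeRing0.T M 2 ℓ hℓ • x)) =
          χ s₂ * Λ₁' (HeckeRing0.T M 2 ℓ hℓ • x) := hΛ₁' s₂ _ hTx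
      have e2 : Λ₁' ((s₂ : HeckeRing0 M 2) • ((w : HeckeRing0 M 2) • x)) =
          χ s₂ * ((w : ZMod p) * Λ₁' x) := by
        rw [hΛ₁' s₂ _ hwx, apply_intCast_smul_of_additive Λ₁' hadd₁' hx w]
      rw [hUw x hx] at e1
      rw [dualMap_heckeT_eq_T_smul hℓ]
      exact mul_left_cancel₀ hcs₂ (e1.symm.trans e2)
    -- the shape on cycles
    have hβmem : ∀ z ∈ periodHomology (M * ℓ),
        (degeneracyMap0 M (M * ℓ) ℓ 2).dualMap z ∈ periodHomology M :=
      fun z hz ↦ dualMap_degeneracyMap0_mem_periodHomology M (M * ℓ) ℓ hℓd hz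
    have hshape : ∀ z ∈ periodHomology (M * ℓ),
        Ψ z = Λ₁' ((degeneracyMap0 M (M * ℓ) 1 2).dualMap z) -
          ((ℓ : ZMod p)⁻¹ * (w : ZMod p)) * Λ₁' ((degeneracyMap0 M (M * ℓ) ℓ 2).dualMap z) := by
      intro z hz
      rw [hold' z hz, hΛ₂'U _ (hβmem z hz), hΛ₁'U _ (hβmem z hz)]
      ring
    -- the level-`M` function `μ`
    obtain ⟨μ, hμ⟩ : ∃ μ : ℚ → ZMod p, ∀ r, μ r = (((θ q₀ : ℤ) : ZMod p) - (q₀ + 1))⁻¹ *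
        Λ₁' (HeckeRing0.T M 2 q₀ hq₀ • σ' r - ((q₀ + 1 : ℕ) : ℂ) • σ' r) := ⟨_, fun _ ↦ rfl⟩
    obtain ⟨hper, hH⟩ := isPeriodic_and_heckeRel_of_eigen Λ₁' χ hadd₁' hΛ₁' σ' hσ' hq₀ hq₀1M _ μ hμ
    refine ⟨μ, hper, fun q hq hqS ↦ ?_, fun r ↦ ?_⟩
    · have hqM : ¬ q ∣ M := fun h ↦ hqS (h.mul_right ℓ)
      have h := hH q hq hqS hqM
      rwa [hχ q hq hqS] at h
    · -- transport the identity from cycles to paths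
      have h := hΨY r
      rw [hshape _ (hY r), hαY, hβY] at h
      have hci : (((θ q₀ : ℤ) : ZMod p) - (q₀ + 1))⁻¹ * (((θ q₀ : ℤ) : ZMod p) - (q₀ + 1)) = 1 :=
        inv_mul_cancel₀ hcne
      rw [hμ, hμ]
      linear_combination -((((θ q₀ : ℤ) : ZMod p) - (q₀ + 1))⁻¹ * h) - φ r * hci

end Assembly

end Summit.BirchSwinnertonDyer.Rank1Residual.LevelLowering

end
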